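import Literature.AlgebraicGeometry.Resolution.AlterationsSectionDivisor
import Literature.AlgebraicGeometry.Resolution.StalkIdealLemmas
import HarnessLib

/-!
# [OURS · L1 W4.5(b) · EL♮(3)] STALKS THROUGH AN ISOMORPHISM OF CLOSED SUBSCHEMES OVER A MORPHISM
# (`V(I₂) ≅ V(I)` over `τ` ⟹ `𝒪_{X,x}/(I_x + 𝔟) ≅ 𝒪_{X₂,y₂}/((I₂)_{y₂} + 𝔟·𝒪)` for every ideal `𝔟`; tool of the (N3′) discharger of TOWER₄'s S6)

Crux chain w45b (cell `res-hironaka`, slot W4.5(b)), working crux **EL♮** = stmt-ResolutionOfSingularities-20038, child **EL♮(3)** =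
stmt-ResolutionOfSingularities-20148, route EquisingularLift, line `sections`; registered stub `stub_elnat_coneTowerPointResolution` @ `ReachTower₄`,
stand-in S6 `hCech`, sub-stand-in (N3′) `hShadowOld` of res-L1-w45b-stub-4's `Tower.hCech₃_of_lift_sec_kiv`. Written by res-L1-w45b-stub-2 g8.
HONEST FRAMING: OURS; NOT a statement of any manuscript; AI-written, weaker than expert review. No `sorry`; standard axioms; DEF-FREE.
`--supports stmt-ResolutionOfSingularities-20148 --as helper`.

WHAT. For a morphism `τ : X₂ → X`, ideal sheaves `I₂` on `X₂`, `I` on `X`, and an isomorphism `e : V(I₂) ≅ V(I)` OVER `τ`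
(`e ≫ ι_I = ι_{I₂} ≫ τ` — in the application: the strict transform `V(St_𝒞 𝓔) ≅ V(𝓔)` of the old exceptional surface through a Čech round,
res-D-pv-051 `exists_iso_subscheme_strictTransformIdeal_exceptional`), at a point `y₂ = ι_{I₂} z`, `x = τ y₂`:
* `stalkMap_comp_surjective_of_iso_over` / `ker_stalkMap_comp_of_iso_over` — `ι_{I₂}♯ ∘ τ♯ : 𝒪_{X,x} → 𝒪_{V(I₂),z}` is ONTO with kernel `I_x`;
* **`exists_sub_stalkMap_mem_of_iso_over`** — every germ of `X₂` at `y₂` is `τ♯ a` modulo `(I₂)_{y₂}`;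
* **`stalkMap_mem_sup_map_iff_of_iso_over`** — `τ♯ b ∈ (I₂)_{y₂} + 𝔟·𝒪_{X₂,y₂} ↔ b ∈ I_x + 𝔟` for every ideal `𝔟 ⊆ 𝒪_{X,x}`;
* **`exists_ringEquiv_quotient_of_iso_over`** — the induced `𝒪_{X,x}/(I_x + 𝔟) ≃+* 𝒪_{X₂,y₂}/((I₂)_{y₂} + 𝔟·𝒪_{X₂,y₂})` through `τ♯`.

References (index only): [cite: GortzWedhorn2020, (13.19)] (strict transform of a subscheme on which the centre is Cartier); tree
`stalkIdeal_ker_eq_ker_stalkMap`, Mathlib `Scheme.Hom.stalkMap_comp`, `Scheme.Hom.ker_comp_of_isIso`.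
-/

set_option linter.dupNamespace false -- mandated namespace `Summit.<Summit>.<Problem>` of this single-conjunct summit

noncomputable section

open CategoryTheory AlgebraicGeometry TopologicalSpace IsLocalRing
open Literature.AlgebraicGeometry.Resolution
open AlgebraicGeometry.Scheme.IdealSheafData

namespace Summit.ResolutionOfSingularities.ResolutionOfSingularities.Cruxes.EquisingularLiftNat.Sections.CechShadow

universe u

variable {X X₂ : Scheme.{u}} (τ : X₂ ⟶ X) (I₂ : X₂.IdealSheafData) (I : X.IdealSheafData)
  (e : I₂.subscheme ≅ I.subscheme) (he : e.hom ≫ I.subschemeι = I₂.subschemeι ≫ τ) (z : I₂.subscheme)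

/-- The composite stalk map `(ι_{I₂} ≫ τ)♯_z` is `ι_{I₂}♯ ∘ τ♯` (as a ring map out of `𝒪_{X, τ y₂}`). [folklore] -/
theorem hom_stalkMap_comp_eq :
    ((I₂.subschemeι ≫ τ).stalkMap z).hom = (I₂.subschemeι.stalkMap z).hom.comp (τ.stalkMap (I₂.subschemeι z)).hom := by
  rw [Scheme.Hom.stalkMap_comp]
  rfl

include he in
/-- `ι_{I₂}♯ ∘ τ♯` is onto at every point of `V(I₂)` (it is the stalk map of the closed immersion `e ≫ ι_I`). [folklore] -/
theorem stalkMap_comp_surjective_of_iso_over :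
    Function.Surjective ((I₂.subschemeι.stalkMap z).hom.comp (τ.stalkMap (I₂.subschemeι z)).hom) := by
  haveI : IsClosedImmersion (I₂.subschemeι ≫ τ) := by rw [← he]; infer_instance
  have h := (I₂.subschemeι ≫ τ).stalkMap_surjective z
  intro r
  obtain ⟨a, ha⟩ := h r
  refine ⟨a, ?_⟩
  rw [← hom_stalkMap_comp_eq]
  exact ha

include he in
/-- The kernel of `ι_{I₂}♯ ∘ τ♯` at `z` is `I_{τ y₂}`. [folklore] -/
theorem ker_stalkMap_comp_of_iso_over :
    RingHom.ker ((I₂.subschemeι.stalkMap z).hom.comp (τ.stalkMap (I₂.subschemeι z)).hom) = stalkIdeal I (τ (I₂.subschemeι z)) := by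
  haveI : IsClosedImmersion (I₂.subschemeι ≫ τ) := by rw [← he]; infer_instance
  have hker : (I₂.subschemeι ≫ τ).ker = I := by
    rw [← he, Scheme.Hom.ker_comp_of_isIso, Scheme.IdealSheafData.ker_subschemeι]
  have h := stalkIdeal_ker_eq_ker_stalkMap (I₂.subschemeι ≫ τ) z
  rw [hker, hom_stalkMap_comp_eq] at h
  exact h.symm

/-- The kernel of `ι_{I₂}♯` at `z` is `(I₂)_{y₂}`. [folklore] -/
theorem ker_stalkMap_subschemeι_eq : RingHom.ker (I₂.subschemeι.stalkMap z).hom = stalkIdeal I₂ (I₂.subschemeι z) := by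
  rw [← stalkIdeal_ker_eq_ker_stalkMap, Scheme.IdealSheafData.ker_subschemeι]

include he in
/-- **Surjectivity modulo `(I₂)_{y₂}`**: every germ of `X₂` at `y₂ = ι_{I₂} z` is congruent to some `τ♯ a` modulo `(I₂)_{y₂}`. [folklore] -/
theorem exists_sub_stalkMap_mem_of_iso_over (r : X₂.presheaf.stalk (I₂.subschemeι z)) :
    ∃ a : X.presheaf.stalk (τ (I₂.subschemeι z)), r - (τ.stalkMap (I₂.subschemeι z)).hom a ∈ stalkIdeal I₂ (I₂.subschemeι z) := by
  obtain ⟨a, ha⟩ := stalkMap_comp_surjective_of_iso_over τ I₂ I e he z ((I₂.subschemeι.stalkMap z).hom r)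
  refine ⟨a, ?_⟩
  rw [← ker_stalkMap_subschemeι_eq, RingHom.mem_ker, map_sub, sub_eq_zero]
  exact ha.symm

include he in
/-- **`τ♯ b ∈ (I₂)_{y₂} + 𝔟·𝒪_{X₂,y₂} ↔ b ∈ I_x + 𝔟`** for every ideal `𝔟 ⊆ 𝒪_{X,x}`, `x = τ y₂`. [folklore] -/
theorem stalkMap_mem_sup_map_iff_of_iso_over (𝔟 : Ideal (X.presheaf.stalk (τ (I₂.subschemeι z)))) (b : X.presheaf.stalk (τ (I₂.subschemeι z))) :
    (τ.stalkMap (I₂.subschemeι z)).hom b ∈ stalkIdeal I₂ (I₂.subschemeι z) ⊔ 𝔟.map (τ.stalkMap (I₂.subschemeι z)).hom ↔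
      b ∈ stalkIdeal I (τ (I₂.subschemeι z)) ⊔ 𝔟 := by
  have hsurj := stalkMap_comp_surjective_of_iso_over τ I₂ I e he z
  have hker := ker_stalkMap_comp_of_iso_over τ I₂ I e he z
  constructor
  · intro hb
    -- apply `ι_{I₂}♯`: `ψ b ∈ ψ(𝔟)`, so `b ∈ 𝔟 + ker ψ = 𝔟 + I_x`
    have h1 : ((I₂.subschemeι.stalkMap z).hom.comp (τ.stalkMap (I₂.subschemeι z)).hom) b ∈
        𝔟.map ((I₂.subschemeι.stalkMap z).hom.comp (τ.stalkMap (I₂.subschemeι z)).hom) := by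
      have h2 := Ideal.mem_map_of_mem (I₂.subschemeι.stalkMap z).hom hb
      have h0 : (stalkIdeal I₂ (I₂.subschemeι z)).map (I₂.subschemeι.stalkMap z).hom = ⊥ := by
        rw [← ker_stalkMap_subschemeι_eq]; exact (Ideal.map_eq_bot_iff_le_ker _).mpr le_rfl
      rw [Ideal.map_sup, h0, bot_sup_eq, Ideal.map_map] at h2
      exact h2
    obtain ⟨c, hc, hψc⟩ : ∃ c : X.presheaf.stalk (τ (I₂.subschemeι z)), c ∈ 𝔟 ∧
        ((I₂.subschemeι.stalkMap z).hom.comp (τ.stalkMap (I₂.subschemeι z)).hom) c =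
          ((I₂.subschemeι.stalkMap z).hom.comp (τ.stalkMap (I₂.subschemeι z)).hom) b :=
      (Ideal.mem_map_iff_of_surjective _ hsurj).mp h1
    have h3 : b - c ∈ RingHom.ker ((I₂.subschemeι.stalkMap z).hom.comp (τ.stalkMap (I₂.subschemeι z)).hom) := by
      rw [RingHom.mem_ker, map_sub, sub_eq_zero]
      exact hψc.symm
    rw [hker] at h3
    have h4 : b = (b - c) + c := by ring
    rw [h4]
    exact Ideal.add_mem _ (Ideal.mem_sup_left h3) (Ideal.mem_sup_right hc)
  · intro hb
    obtain ⟨i, hi, c, hc, rfl⟩ := Submodule.mem_sup.mp hb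
    rw [map_add]
    refine Ideal.add_mem _ (Ideal.mem_sup_left ?_) (Ideal.mem_sup_right (Ideal.mem_map_of_mem _ hc))
    -- `τ♯ i ∈ (I₂)_{y₂}`: its image under `ι_{I₂}♯` vanishes
    rw [← ker_stalkMap_subschemeι_eq, RingHom.mem_ker]
    have h1 : i ∈ RingHom.ker ((I₂.subschemeι.stalkMap z).hom.comp (τ.stalkMap (I₂.subschemeι z)).hom) := by rw [hker]; exact hi
    exact h1

include he in
/-- **The quotient isomorphism through `τ♯`**: `𝒪_{X,x}/(I_x + 𝔟) ≃+* 𝒪_{X₂,y₂}/((I₂)_{y₂} + 𝔟·𝒪_{X₂,y₂})`, mapping the class of `a` to the class of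
`τ♯ a`. [cite: GortzWedhorn2020, (13.19)] [OURS · L1 W4.5b] -/
theorem exists_ringEquiv_quotient_of_iso_over (𝔟 : Ideal (X.presheaf.stalk (τ (I₂.subschemeι z)))) :
    ∃ Θ : X.presheaf.stalk (τ (I₂.subschemeι z)) ⧸ (stalkIdeal I (τ (I₂.subschemeι z)) ⊔ 𝔟) ≃+*
        X₂.presheaf.stalk (I₂.subschemeι z) ⧸ (stalkIdeal I₂ (I₂.subschemeι z) ⊔ 𝔟.map (τ.stalkMap (I₂.subschemeι z)).hom),
      ∀ a, Θ (Ideal.Quotient.mk _ a) = Ideal.Quotient.mk _ ((τ.stalkMap (I₂.subschemeι z)).hom a) := by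
  obtain ⟨J₂, hJ₂⟩ : ∃ J₂ : Ideal (X₂.presheaf.stalk (I₂.subschemeι z)),
      J₂ = stalkIdeal I₂ (I₂.subschemeι z) ⊔ 𝔟.map (τ.stalkMap (I₂.subschemeι z)).hom := ⟨_, rfl⟩
  let φ : (X.presheaf.stalk (τ (I₂.subschemeι z)) : Type u) →+* (X₂.presheaf.stalk (I₂.subschemeι z) ⧸ J₂) :=
    (Ideal.Quotient.mk J₂).comp (τ.stalkMap (I₂.subschemeι z)).hom
  have hφ : ∀ a, φ a = Ideal.Quotient.mk J₂ ((τ.stalkMap (I₂.subschemeι z)).hom a) := fun a => rfl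
  have hφsurj : Function.Surjective φ := by
    intro r
    obtain ⟨r, rfl⟩ := Ideal.Quotient.mk_surjective r
    obtain ⟨a, ha⟩ := exists_sub_stalkMap_mem_of_iso_over τ I₂ I e he z r
    refine ⟨a, ?_⟩
    rw [hφ, eq_comm, Ideal.Quotient.eq, hJ₂]
    exact Ideal.mem_sup_left ha
  have hkerφ : RingHom.ker φ = stalkIdeal I (τ (I₂.subschemeι z)) ⊔ 𝔟 := by
    ext b
    rw [RingHom.mem_ker, hφ, Ideal.Quotient.eq_zero_iff_mem, hJ₂]
    exact stalkMap_mem_sup_map_iff_of_iso_over τ I₂ I e he z 𝔟 b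
  subst hJ₂
  refine ⟨(Ideal.quotEquivOfEq hkerφ.symm).trans (RingHom.quotientKerEquivOfSurjective hφsurj), fun a => ?_⟩
  rw [RingEquiv.trans_apply]
  have h1 : (Ideal.quotEquivOfEq hkerφ.symm) (Ideal.Quotient.mk _ a) = Ideal.Quotient.mk (RingHom.ker φ) a := rfl
  rw [h1, RingHom.quotientKerEquivOfSurjective_apply_mk]
  exact hφ a

end Summit.ResolutionOfSingularities.ResolutionOfSingularities.Cruxes.EquisingularLiftNat.Sections.CechShadow

end
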